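import Summits.ResolutionOfSingularities.ResolutionOfSingularities.Theses.RuledResidues

/-!
# Crux `NonRuledDivisors` (stmt-ResolutionOfSingularities-18075), line `automorphism-orbit` —
# engine (A) of `stub_orbitGerm` needs a NON-SURJECTIVE endomorphism of the affine model

The registered line `Cruxes/NonRuledDivisors/Lines/automorphism_orbit.lean` reduces the crux to
`stub_orbitGerm`: ONE non-ruled divisorial place `W` over a singular point `P` of an affine model
`R ⊆ K` plus a ring automorphism `τ` of `K` with `τ R ⊆ R`, `τ P ⊆ P`, and one of two injectivity
certificates for the orbit `n ↦ W.comap τⁿ`; the first (engine A, "contraction") is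
`P ≠ ⊥ ∧ τ P ⊆ P²`.

Negative-side support (crux disprover, cycle 1), sorry-free, definition-free, resolution-free and
characteristic-free:

* `orbitGerm_no_contraction_of_surjOn` — if `τ` maps a NOETHERIAN subring `S ⊆ K` ONTO itself, no
  ideal `P ≠ ⊥, ⊤` of `S` satisfies `τ P ⊆ P²`.  Proof: the chain `P ⊆ τ⁻¹P ⊆ τ⁻²P ⊆ …`
  (monotone since `τP ⊆ P² ⊆ P`) stabilises; surjectivity of `τ|S` then gives `τ⁻¹P ⊆ P`, so
  `P = τP ⊆ P²`, `P` is idempotent, hence `⊥` or `⊤` in the domain `S`.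
* `orbitGerm_engineA_false_of_surjOn` — the same in the exact vocabulary of `stub_orbitGerm`
  (`R : Subalgebra k K`, `R.FG`, `P : Ideal R.toSubring` prime): if `τ` maps `R` onto `R`, the
  engine-(A) disjunct is impossible.

Moral for hunters: an engine-(A) germ uses a birational but NON-surjective endomorphism of its affine
model (`τ R ⊊ R`, e.g. a monomial contraction `(x, y) ↦ (xy, xy²)` of the ambient space); no
automorphism of the singular germ — in particular no element of a finite group `G` acting on it, and
no automorphism of `A^G` — can ever serve as the contraction.  This file does NOT refute the crux or
the stub (it removes a habitat).
-/

set_option linter.dupNamespace false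

namespace Summit.ResolutionOfSingularities.ResolutionOfSingularities.Theorems

/-- **No contraction into `P²` by a map that is onto the (Noetherian) ring.**  `S ⊆ K` a Noetherian
subring, `P` an ideal of `S` with `P ≠ ⊥` and `P ≠ ⊤`, `τ` a ring automorphism of `K` with
`τ S = S` (into and onto); then `τ P ⊆ P²` is impossible. [folklore] -/
theorem orbitGerm_no_contraction_of_surjOn {K : Type*} [Field K] (S : Subring K)
    [IsNoetherianRing S] (P : Ideal S) (hPbot : P ≠ ⊥) (hPtop : P ≠ ⊤) (τ : K ≃+* K)
    (hS : ∀ r : K, r ∈ S → τ r ∈ S) (hsurj : ∀ r : K, r ∈ S → ∃ r' : K, r' ∈ S ∧ τ r' = r)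
    (hcon : ∀ r : S, r ∈ P → ∃ r' : S, r' ∈ P ^ 2 ∧ (r' : K) = τ (r : K)) : False := by
  -- the restriction of `τ` to `S`
  let σ : S →+* S := (τ : K →+* K).restrict S S hS
  have hσ : ∀ x : S, ((σ x : S) : K) = τ (x : K) := fun x => rfl
  have hσsurj : Function.Surjective σ := by
    intro y
    obtain ⟨r', hr'S, hr'⟩ := hsurj y y.2
    exact ⟨⟨r', hr'S⟩, Subtype.ext (by rw [hσ]; exact hr')⟩
  have hPσ : ∀ x : S, x ∈ P → σ x ∈ P ^ 2 := by
    intro x hx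
    obtain ⟨r', hr'P, hr'eq⟩ := hcon x hx
    have : σ x = r' := Subtype.ext (by rw [hσ]; exact hr'eq.symm)
    rw [this]
    exact hr'P
  -- the chain `n ↦ (τ|S)⁻ⁿ P` is monotone, hence stationary
  have hmono : Monotone fun n : ℕ => P.comap (σ ^ n) := by
    refine monotone_nat_of_le_succ fun n => ?_
    intro x hx
    rw [Ideal.mem_comap, RingHom.coe_pow] at hx ⊢
    rw [Function.iterate_succ_apply']
    exact Ideal.pow_le_self two_ne_zero (hPσ _ hx)
  obtain ⟨N, hN⟩ :=
    monotone_stabilizes_iff_noetherian.mpr (inferInstance : IsNoetherian S S) ⟨_, hmono⟩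
  -- `τ⁻¹ P ⊆ P`
  have hback : ∀ r : S, σ r ∈ P → r ∈ P := by
    intro r hr
    obtain ⟨u, rfl⟩ := (hσsurj.iterate N) r
    have hu : u ∈ P.comap (σ ^ (N + 1)) := by
      rw [Ideal.mem_comap, RingHom.coe_pow, Function.iterate_succ_apply']
      exact hr
    have hN' : P.comap (σ ^ N) = P.comap (σ ^ (N + 1)) := hN (N + 1) (Nat.le_succ N)
    rw [← hN', Ideal.mem_comap, RingHom.coe_pow] at hu
    exact hu
  -- `P ⊆ P²`, so `P` is idempotent
  have hPP : P ≤ P ^ 2 := by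
    intro s hs
    obtain ⟨r, rfl⟩ := hσsurj s
    exact hPσ r (hback r hs)
  have hidem : IsIdempotentElem P := by
    change P * P = P
    refine le_antisymm Ideal.mul_le_right ?_
    rw [← pow_two]
    exact hPP
  rcases (Ideal.isIdempotentElem_iff_eq_bot_or_top P (IsNoetherian.noetherian P)).mp hidem with h | h
  · exact hPbot h
  · exact hPtop h

/-- **Engine (A) of `stub_orbitGerm` is void for maps onto the affine model.**  For an affine model
`R` (finitely generated `k`-subalgebra of `K`), a prime `P` of `R` and a ring automorphism `τ` of
`K` mapping `R` ONTO `R`, the certificate `P ≠ ⊥ ∧ τ P ⊆ P²` (first disjunct of `stub_orbitGerm`,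
verbatim) fails. [folklore] -/
theorem orbitGerm_engineA_false_of_surjOn {k K : Type} [Field k] [Field K] [Algebra k K]
    (R : Subalgebra k K) (hR : R.FG) (P : Ideal R.toSubring) [P.IsPrime] (τ : K ≃+* K)
    (hRτ : ∀ r : K, r ∈ R → τ r ∈ R) (hsurj : ∀ r : K, r ∈ R → ∃ r' : K, r' ∈ R ∧ τ r' = r) :
    ¬ (P ≠ ⊥ ∧ ∀ r : R.toSubring, r ∈ P → ∃ r' : R.toSubring, r' ∈ P ^ 2 ∧ (r' : K) = τ (r : K)) := by
  rintro ⟨hPbot, hcon⟩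
  haveI : Algebra.FiniteType k R := R.fg_iff_finiteType.mp hR
  haveI : IsNoetherianRing R := Algebra.FiniteType.isNoetherianRing k R
  haveI : IsNoetherianRing R.toSubring := (inferInstance : IsNoetherianRing R)
  exact orbitGerm_no_contraction_of_surjOn R.toSubring P hPbot (Ideal.IsPrime.ne_top inferInstance) τ
    hRτ hsurj hcon

end Summit.ResolutionOfSingularities.ResolutionOfSingularities.Theorems
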